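import Mathlib
import HarnessLib
import Literature.Computability.AlgebraicComplexity.PatternExpressions
import Summits.ValiantsHypothesis.ValiantsHypothesis.Theorems.MonotoneRestorationOrbitCompressionQPNarrowPostComposition

/-!
# Route MonotoneRestoration — aside `OrbitCompressionQP` (stmt-ValiantsHypothesis-18332), line
# `expression_compression`: the `k`-ROW STRATUM in polarised power-sum coordinates

After the one-row stratum (`Theorems/…OneRowStratum.lean`, unconditional via Bläser–Jindal), the next strata
of `stub_narrowExpressionCompression` are the families supported on `k` rows at a time:
`f_n = Σ_{i_1, …, i_k} g_n(row i_1, …, row i_k)` with `g_n ∈ ℂ[x_{a,v} : a < k, v < n]` invariant under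
`Sym_n` acting diagonally on the columns `v` (MacMahon's vector-symmetric polynomials).  Their invariant ring
is generated — not freely for `k ≥ 2` — by the POLARISED POWER SUMS `p_α = Σ_v Π_a x_{a,v}^{α_a}`
(`α ∈ ℕ^k`), which are `(k,1)`-label pattern expressions (`sumCol` of a monomial in the edges `(a, 0)`).
The `VQP` substitution principle therefore settles the stratum IN POWER-SUM COORDINATES:

* `exists_monomial_edges` — the monomial `Π_a x_{ρ a, γ 0}^{α_a}` as a `(k,1)`-expression of length
  `≤ 2|α| + 2k + 1`; `exists_polarisedPowerSum` — `p_α(rows ρ)` of length `≤ 2|α| + 2k + 2`;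
* ★ `narrowQP_multiRowPowerSumSubst` — for every `k`, every `VQP` family `Q_n ∈ ℂ[y_1, …, y_{m(n)}]` and
  exponent vectors `α_{n,j} ∈ ℕ^k` of p-bounded weight, the matrix-symmetric family
  `f_n = Σ_{ρ : [k] → [n]} Q_n(p_{α_{n,1}}(rows ρ), …, p_{α_{n,m(n)}}(rows ρ))` is narrow of quasi-polynomial
  length (`k` row labels, one column label).

What is NOT here and not in print: the `k ≥ 2` analogue of Bläser–Jindal (a `VP` vector-symmetric `g_n`
has SOME representation `Q_n(p_α)` with `Q_n ∈ VQP`) — the representation is not unique, and no complexity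
bound for a good choice is known; modulo that, the `k`-row stratum of the stub holds for every fixed `k`.

Helper file (`--supports stmt-ValiantsHypothesis-18332`); def-free; nothing here is a named fact; no registered
stub is closed; VP ≠ VNP is not moved.
-/

noncomputable section

open MvPolynomial

-- `Summit.ValiantsHypothesis.ValiantsHypothesis.…` is the tree's single-conjunct layout (Sub = Summit).
set_option linter.dupNamespace false

namespace Summit.ValiantsHypothesis.ValiantsHypothesis.Theorems

namespace FormulaSubstitution

open Literature.Computability.AlgebraicComplexity OrbitRestorationQPHomPolyClose

/-! ### Polarised power sums as pattern expressions -/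

section SingleLevel

variable {F : Type} [CommSemiring F] {k : ℕ}

/-- A monomial in the edges `(a, 0)`, `a ∈ s`: length `≤ 1 + Σ_{a ∈ s} (2 α_a + 2)`, value
`Π_{a ∈ s} x_{ρ a, γ 0}^{α_a}`. [folklore] -/
theorem exists_monomial_edges_finset (α : Fin k → ℕ) (s : Finset (Fin k)) :
    ∃ e : PatternExpr F k 1, e.length ≤ 1 + ∑ a ∈ s, (2 * α a + 2) ∧
      ∀ (n : ℕ) (ρ : Fin k → Fin n) (γ : Fin 1 → Fin n),
        e.value n ρ γ = ∏ a ∈ s, X (ρ a, γ 0) ^ α a := by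
  classical
  induction s using Finset.induction_on with
  | empty => exact ⟨PatternExpr.const 1, by simp [PatternExpr.length], fun n ρ γ => by simp⟩
  | insert a s ha ih =>
    obtain ⟨e, hl, hv⟩ := ih
    obtain ⟨q, hql, hqv⟩ := exists_edge_pow (F := F) (k := k) (l := 1) a 0 (α a)
    refine ⟨PatternExpr.mul q e, ?_, fun n ρ γ => ?_⟩
    · rw [Finset.sum_insert ha]
      simp only [PatternExpr.length, hql]
      omega
    · rw [Finset.prod_insert ha, PatternExpr.value_mul, hqv, hv]

/-- **Polarised power sums**: `p_α(rows ρ) = Σ_v Π_a x_{ρ a, v}^{α_a}` is the value of a `(k,1)`-label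
expression of length `≤ 2|α| + 2k + 2` (independent of the column label). [folklore] -/
theorem exists_polarisedPowerSum (α : Fin k → ℕ) :
    ∃ e : PatternExpr F k 1, e.length ≤ 2 * (∑ a, α a) + 2 * k + 2 ∧
      ∀ (n : ℕ) (ρ : Fin k → Fin n) (γ : Fin 1 → Fin n),
        e.value n ρ γ = ∑ v : Fin n, ∏ a : Fin k, X (ρ a, v) ^ α a := by
  obtain ⟨e, hl, hv⟩ := exists_monomial_edges_finset (F := F) α Finset.univ
  refine ⟨PatternExpr.sumCol 0 e, ?_, fun n ρ γ => by simp [hv]⟩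
  simp only [PatternExpr.length]
  have : ∑ a : Fin k, (2 * α a + 2) = 2 * ∑ a, α a + 2 * k := by
    rw [Finset.sum_add_distrib, Finset.mul_sum]; simp [mul_comm]
  omega

/-- Summing out ALL `k` row labels of an expression whose value does not depend on the column label:
value `Σ_{ρ'} G ρ'` at every assignment, length `|e| + k`. [folklore] -/
theorem exists_sumRows {n : ℕ} (e : PatternExpr F k 1) (G : (Fin k → Fin n) → MvPolynomial (Fin n × Fin n) F)
    (hG : ∀ (ρ : Fin k → Fin n) (γ : Fin 1 → Fin n), e.value n ρ γ = G ρ) :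
    ∃ e' : PatternExpr F k 1, e'.length = e.length + k ∧
      ∀ (ρ : Fin k → Fin n) (γ : Fin 1 → Fin n), e'.value n ρ γ = ∑ ρ' : Fin k → Fin n, G ρ' := by
  refine ⟨(List.finRange k).foldr PatternExpr.sumRow e,
    by rw [NarrowClosure.length_foldr_sumRow, List.length_finRange], fun ρ γ => ?_⟩
  rw [value_foldr_sumRow n e γ (List.finRange k) (List.nodup_finRange k) ρ]
  have hk : Finset.univ.filter (fun ρ' : Fin k → Fin n => ∀ a, a ∉ List.finRange k → ρ' a = ρ a)
      = Finset.univ :=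
    Finset.filter_true_of_mem fun ρ' _ a ha => absurd (List.mem_finRange a) ha
  rw [hk]
  exact Finset.sum_congr rfl fun ρ' _ => hG ρ' γ

end SingleLevel

/-! ### The `k`-row stratum -/

section Strata

/-- ★ **The `k`-row stratum in polarised power-sum coordinates is narrow of quasi-polynomial length.**  For
every `k`, every `VQP` family `Q_n ∈ ℂ[y_1, …, y_{m(n)}]` and exponent vectors `α_{n,j} ∈ ℕ^k` (`j < m n`) of
p-bounded weight `|α_{n,j}| ≤ d n`, the matrix-symmetric family
`f_n = Σ_{ρ : [k] → [n]} Q_n(p_{α_{n,0}}(rows ρ), …)`, `p_α(rows ρ) = Σ_v Π_a x_{ρ a, v}^{α_a}`, satisfies the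
conclusion of `stub_narrowExpressionCompression` (with `k` row labels and one column label).
[cite: BurgisserClausenShokrollahi1997, Thm. (21.33)] -/
theorem narrowQP_multiRowPowerSumSubst (k : ℕ) {m d : ℕ → ℕ} (hd : IsPBounded d)
    (Q : (n : ℕ) → MvPolynomial (Fin (m n)) ℂ) (hQ : IsVQPFamily Q)
    (α : (n : ℕ) → Fin (m n) → Fin k → ℕ) (hα : ∀ n j, ∑ a, α n j a ≤ d n) :
    ∃ c : ℕ, ∀ n : ℕ, 1 ≤ n → ∃ (k' l : ℕ) (e : PatternExpr ℂ k' l),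
      n ^ (k' + l) ≤ 2 ^ ((Nat.log 2 n + c) ^ c) ∧ e.length ≤ 2 ^ ((Nat.log 2 n + c) ^ c) ∧
      e.close n = ∑ ρ : Fin k → Fin n, aeval (fun j : Fin (m n) =>
        ∑ v : Fin n, ∏ a : Fin k, (X (ρ a, v) : MvPolynomial (Fin n × Fin n) ℂ) ^ α n j a) (Q n) := by
  classical
  have hθex : ∀ (n : ℕ) (j : Fin (m n)), ∃ e : PatternExpr ℂ k 1,
      e.length ≤ 2 * d n + 2 * k + 2 ∧
      ∀ (ρ : Fin k → Fin n) (γ : Fin 1 → Fin n),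
        e.value n ρ γ = ∑ v : Fin n, ∏ a : Fin k, (X (ρ a, v) : MvPolynomial (Fin n × Fin n) ℂ) ^ α n j a := by
    intro n j
    obtain ⟨e, hl, hv⟩ := exists_polarisedPowerSum (F := ℂ) (α n j)
    exact ⟨e, hl.trans (by have := hα n j; omega), fun ρ γ => hv n ρ γ⟩
  choose θ hθl hθv using hθex
  obtain ⟨a, ha⟩ := hd
  have hθ : ∃ c : ℕ, ∀ n : ℕ, 1 ≤ n → ∀ j : Fin (m n), (θ n j).length ≤ 2 ^ ((Nat.log 2 n + c) ^ c) := by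
    obtain ⟨c, hc⟩ := NarrowClosure.qp_combine (a + 1) (2 * k + 1)
    refine ⟨c, fun n _ j => ?_⟩
    have h1 : n ^ a + a ≤ 2 ^ ((Nat.log 2 n + (a + 1)) ^ (a + 1)) := CompressionFloors.pbounded_le_qp n a
    have h2 : n ^ (2 * k) + 2 * k ≤ 2 ^ ((Nat.log 2 n + (2 * k + 1)) ^ (2 * k + 1)) :=
      CompressionFloors.pbounded_le_qp n (2 * k)
    have h3 := hc (Nat.log 2 n) (n ^ a + a) (n ^ (2 * k) + 2 * k) h1 h2
    have h4 := hθl n j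
    have h5 := ha n
    have hprod : 2 * (n ^ a + a) + 2 * k + 2 ≤ (n ^ a + a + 2) * (n ^ (2 * k) + 2 * k + 2) := by
      generalize n ^ a + a = X
      generalize hY : n ^ (2 * k) + 2 * k = Y
      have hY' : 2 * k ≤ Y := by rw [← hY]; exact Nat.le_add_left _ _
      nlinarith [Nat.zero_le (X * Y)]
    omega
  obtain ⟨c₁, hc₁⟩ := exists_narrow_subst_of_isVQPFamily Q hQ (k := fun _ => k) (l := fun _ => 1) θ hθ
  obtain ⟨c₂, hc₂⟩ := NarrowClosure.qp_combine c₁ (k + 1)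
  refine ⟨max c₂ (k + 2), fun n hn => ?_⟩
  obtain ⟨e, hl, hv⟩ := hc₁ n hn
  set G : (Fin k → Fin n) → MvPolynomial (Fin n × Fin n) ℂ := fun ρ => aeval (fun j : Fin (m n) =>
    ∑ v : Fin n, ∏ a : Fin k, (X (ρ a, v) : MvPolynomial (Fin n × Fin n) ℂ) ^ α n j a) (Q n) with hG
  have hval : ∀ (ρ : Fin k → Fin n) (γ : Fin 1 → Fin n), e.value n ρ γ = G ρ := by
    intro ρ γ
    have hfun : (fun j : Fin (m n) => (θ n j).value n ρ γ) = fun j : Fin (m n) =>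
        ∑ v : Fin n, ∏ a : Fin k, (X (ρ a, v) : MvPolynomial (Fin n × Fin n) ℂ) ^ α n j a :=
      funext fun j => hθv n j ρ γ
    rw [hv, hfun]
  obtain ⟨e₁, hl₁, hv₁⟩ := exists_sumRows e G hval
  obtain ⟨e₂, hl₂, hc₂'⟩ := exists_close_eq_of_value_const_kl hn e₁ _ hv₁
  refine ⟨k, 1, e₂, ?_, ?_, hc₂'⟩
  · calc n ^ (k + 1) ≤ n ^ (k + 1) + (k + 1) := Nat.le_add_right _ _
      _ ≤ 2 ^ ((Nat.log 2 n + (k + 2)) ^ (k + 2)) := CompressionFloors.pbounded_le_qp n (k + 1)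
      _ ≤ 2 ^ ((Nat.log 2 n + max c₂ (k + 2)) ^ max c₂ (k + 2)) :=
          Nat.pow_le_pow_right (by norm_num) (CompressionFloors.polylog_mono (le_max_right _ _))
  · have hk : n ^ k + k ≤ 2 ^ ((Nat.log 2 n + (k + 1)) ^ (k + 1)) := CompressionFloors.pbounded_le_qp n k
    have h := hc₂ (Nat.log 2 n) e.length (n ^ k + k) hl hk
    have hk1 : k ≤ n ^ k + k := Nat.le_add_left _ _
    calc e₂.length = e.length + k + 2 := by rw [hl₂, hl₁]
      _ ≤ (e.length + 2) * (n ^ k + k + 2) := by nlinarith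
      _ ≤ 2 ^ ((Nat.log 2 n + c₂) ^ c₂) := h
      _ ≤ 2 ^ ((Nat.log 2 n + max c₂ (k + 2)) ^ max c₂ (k + 2)) :=
          Nat.pow_le_pow_right (by norm_num) (CompressionFloors.polylog_mono (le_max_left _ _))

/-- **The `k`-row power-sum stratum is matrix-symmetric** (so it lies in the scope of the stub).
[folklore] -/
theorem multiRowPowerSum_matrixSymmetric {k n m : ℕ} (Q : MvPolynomial (Fin m) ℂ)
    (α : Fin m → Fin k → ℕ) (σ τ : Equiv.Perm (Fin n)) :
    rename (fun p : Fin n × Fin n => (σ p.1, τ p.2))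
      (∑ ρ : Fin k → Fin n, aeval (fun j : Fin m =>
        ∑ v : Fin n, ∏ a : Fin k, (X (ρ a, v) : MvPolynomial (Fin n × Fin n) ℂ) ^ α j a) Q) =
      ∑ ρ : Fin k → Fin n, aeval (fun j : Fin m =>
        ∑ v : Fin n, ∏ a : Fin k, (X (ρ a, v) : MvPolynomial (Fin n × Fin n) ℂ) ^ α j a) Q := by
  rw [map_sum]
  have hterm : ∀ ρ : Fin k → Fin n, rename (fun p : Fin n × Fin n => (σ p.1, τ p.2))
      (aeval (fun j : Fin m =>
        ∑ v : Fin n, ∏ a : Fin k, (X (ρ a, v) : MvPolynomial (Fin n × Fin n) ℂ) ^ α j a) Q) =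
      aeval (fun j : Fin m =>
        ∑ v : Fin n, ∏ a : Fin k, (X ((σ ∘ ρ) a, v) : MvPolynomial (Fin n × Fin n) ℂ) ^ α j a) Q := by
    intro ρ
    rw [← AlgHom.comp_apply, comp_aeval]
    have hfun : (fun j : Fin m => rename (fun p : Fin n × Fin n => (σ p.1, τ p.2))
        (∑ v : Fin n, ∏ a : Fin k, (X (ρ a, v) : MvPolynomial (Fin n × Fin n) ℂ) ^ α j a)) =
        fun j : Fin m =>
          ∑ v : Fin n, ∏ a : Fin k, (X ((σ ∘ ρ) a, v) : MvPolynomial (Fin n × Fin n) ℂ) ^ α j a := by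
      funext j
      simp only [map_sum, map_prod, map_pow, rename_X, Function.comp_apply]
      exact Fintype.sum_equiv τ _ _ fun v => rfl
    rw [hfun]
  simp_rw [hterm]
  exact Fintype.sum_equiv ((Equiv.refl (Fin k)).arrowCongr σ) _ _ fun ρ => rfl

end Strata

end FormulaSubstitution

end Summit.ValiantsHypothesis.ValiantsHypothesis.Theorems

end
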